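import Mathlib
import Summits.NavierStokesRegularity.NavierStokesRegularity.Theorems.TaoLadderRungTwoBreakOneShiftWindowKrawczykMatrix
import HarnessLib

/-!
# The one-shift window system, X: the contraction hypothesis (K1) of the Krawczyk clauses from a SLOPE MATRIX
# of the preconditioned residual — the flight-time column as a LIPSCHITZ slope, the window block row-wise by
# the mean value theorem (cell harvest/h2-tao-ladder, seat p2; rung1/KERNEL-CHEAP-REPLAY-SPEC.md §5 (v),
# rung1/RUNG1-P2G12-REPORT.md §53; support for K1(1) = `NoSurvivingDSSOne`, stmt-NavierStokesRegularity-20205)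

MODEL lattice ODEs only (Tao 2016 §4 normal form on Tao's shift set `S`); nothing here is a statement about
the Navier–Stokes equations; no item is closed; nothing numerical is proved.

Parts VII/VIII obtain (K1) from a DERIVATIVE of the scaled Krawczyk map `ξ ↦ ξ − P(ξ, t)` within the unit
ball of `WState × ℝ` plus row sums of its coordinate matrix. That cannot be fed as is: the residual reads the
top tail VALUE `T_W(τ)` and the window run at the flight time, and an admissible tail is only `R`-Lipschitz in
time — the map is NOT differentiable in the flight-time coordinate (SPEC §5 (v)). What a replay delivers, and
all that (K1) needs, is a SLOPE MATRIX: for every two admissible points `u, v` with the same tails a real matrix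
`M` (depending on the pair) with `coord (ξ_u − P u) r − coord (ξ_v − P v) r = Σ_c M r c · (coord ξ_u c − coord ξ_v c)`
for every row `r`, entries inside an interval matrix `[R] = I − S⁻¹ C [N]` (`[N]` = interval SLOPE matrix of the
residual in scaled columns: window columns enclose row-wise derivatives at intermediate points, the flight-time
column encloses difference quotients — `g·f`-hull, `R_W`). Then `|row r| ≤ (Σ_c mag [R]_{rc}) · dist(u, v)`:
(K1) with `Z = max_r Σ_c mag [R]_{rc}`, the number the engine prints (`Z = 8.6e-4` for T4 @ 1/10, W = 76).

* `WIdx`, `coord`, `bscale` — coordinates of the window block (`none` = flight time), block scales `S`;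
  `kval u = ξ_u − P u`, `gval u` = the residual at the pre-clamped data;
* `K1_of_slope` — (K1) from a slope matrix with magnitude bounds and row sums `≤ Z` (pure algebra);
* `kval_slope_of_residualSlope`, `K1_of_residualSlope` — LINEAR preconditioner `Cmat`: a residual slope matrix
  `N ∈ [Nlo, Nhi]` gives the Krawczyk slope matrix `δ_{rc} − (Σ_{r'} Cmat r r' N r' c) / S_r`; (K1) from magnitude
  bounds valid for EVERY `N ∈ [Nlo, Nhi]` (interval linear algebra) and row sums;
* `exists_slope_row_of_hasFDerivWithinAt` (row-wise mean value theorem on a convex set — each row its own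
  intermediate point), `exists_slope_of_lipschitz` (a Lipschitz column);
* `K1_of_fderiv_y_lipschitz_τ` — the sibling of part VIII announced in SPEC §5 (v): row-wise derivatives in the
  window start with entry bounds + a Lipschitz flight-time column + full row sums `≤ Z` ⇒ (K1).
-/

noncomputable section

-- the sub-problem namespace repeats the summit name by design (D-0017)
set_option linter.dupNamespace false

namespace Summit.NavierStokesRegularity.NavierStokesRegularity.Theorems

namespace DSSOneShift

open Set Metric Literature.Analysis.FluidPDE Literature.Analysis.FluidPDE.TaoCascade CertificateGlueOn

variable {m : ℕ}

namespace OneShiftFrame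

variable (F : OneShiftFrame m)

/-! ### Coordinates of the window block -/

/-- The coordinate index of the window block: `some (i, k)` = window component, `none` = flight time.
[folklore] -/
abbrev WIdx : Type := Option (Fin m × Fin F.W)

/-- The coordinate functionals of `WState × ℝ`. [folklore] -/
def coord (ξ : F.WState × ℝ) : F.WIdx → ℝ := fun r => r.elim ξ.2 fun p => ξ.1 p.1 p.2

/-- Window coordinate. [folklore] -/
@[simp] theorem coord_some (ξ : F.WState × ℝ) (i : Fin m) (k : Fin F.W) : F.coord ξ (some (i, k)) = ξ.1 i k :=
  rfl

/-- Window coordinate (pair form). [folklore] -/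
@[simp] theorem coord_some' (ξ : F.WState × ℝ) (p : Fin m × Fin F.W) : F.coord ξ (some p) = ξ.1 p.1 p.2 := rfl

/-- Flight-time coordinate. [folklore] -/
@[simp] theorem coord_none (ξ : F.WState × ℝ) : F.coord ξ none = ξ.2 := rfl

/-- Coordinates are additive. [folklore] -/
theorem coord_sub (ξ η : F.WState × ℝ) (r : F.WIdx) : F.coord (ξ - η) r = F.coord ξ r - F.coord η r := by
  rcases r with _ | ⟨i, k⟩ <;> rfl

/-- The coordinate vectors of part VIII in the `Option` indexing. [folklore] -/
def eIdx : F.WIdx → F.WState × ℝ := fun c => c.elim F.eT fun p => F.eW p.1 p.2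

/-- Every vector is the coordinate combination of the coordinate vectors (part VIII `sum_coord_smul`,
`Option`-indexed). [folklore] -/
theorem sum_coord_smul_eIdx (x : F.WState × ℝ) : ∑ c, F.coord x c • F.eIdx c = x := by
  rw [Fintype.sum_option, Fintype.sum_prod_type]
  show x.2 • F.eT + ∑ j, ∑ l, x.1 j l • F.eW j l = x
  rw [add_comm]
  exact F.sum_coord_smul x

/-- The block scales `S`: box radius `a_{i,k}` on a window coordinate, `r_τ` on the flight time. [cite: Tao2016AveragedNS, §5.3; cell vocabulary, harvest/h2-tao-ladder rung1/STAGE2-LEMMA.md §2 (scaled coordinates)] -/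
def bscale : F.WIdx → ℝ := fun r => r.elim F.rτ fun p => F.a p.1 ((p.2 : ℕ) : ℤ)

/-- The block scales are positive. [folklore] -/
theorem bscale_pos (r : F.WIdx) : 0 < F.bscale r := by
  rcases r with _ | ⟨i, k⟩; exacts [F.rτ_pos, F.a_pos i _]

/-- A coordinate difference of the window parts is bounded by the distance in trajectory space. [folklore] -/
theorem abs_coord_winPart_sub_le_dist (u v : F.Space) (r : F.WIdx) :
    |F.coord (F.winPart u) r - F.coord (F.winPart v) r| ≤ dist u v := by
  rcases r with _ | ⟨i, k⟩; exacts [F.abs_snd_sub_le_dist u v, F.abs_fst_sub_le_dist u v i k]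

/-! ### The Krawczyk value and the residual value of a point -/

/-- The (unscaled, unpreconditioned) residual `G` at the pre-clamped data of a point of trajectory space.
[cite: Tao2016AveragedNS, §5.3; cell vocabulary, harvest/h2-tao-ladder rung1/STAGE2-LEMMA.md §2 (G)] -/
def gval (ε₀ : ℝ) (α : Fin m → Fin m → Fin m → ℤ × ℤ × ℤ → ℝ) (u : F.Space) : F.WState × ℝ :=
  F.residual ε₀ α (F.preclampTail u) (F.preclampY u, F.preclampTau u)

/-- The Krawczyk value `ξ_u − P(u)` of a point (`= krawczykMap` at the tails of `u`, `kval_eq_krawczykMap`).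
[cite: Tao2016AveragedNS, §5.3; cell vocabulary, harvest/h2-tao-ladder rung1/STAGE2-LEMMA.md §2 (N = x − C·G)] -/
def kval (ε₀ : ℝ) (α : Fin m → Fin m → Fin m → ℤ × ℤ × ℤ → ℝ) (C : F.WState × ℝ → F.WState × ℝ)
    (u : F.Space) : F.WState × ℝ :=
  F.winPart u - F.precondResidual ε₀ α C u

/-- `kval` is the Krawczyk map of part VII at the point's own tails. [folklore] -/
theorem kval_eq_krawczykMap (ε₀ : ℝ) (α : Fin m → Fin m → Fin m → ℤ × ℤ × ℤ → ℝ)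
    (C : F.WState × ℝ → F.WState × ℝ) (u : F.Space) :
    F.kval ε₀ α C u = F.krawczykMap ε₀ α C u.2.2 (F.winPart u) := by
  rw [krawczykMap, pointOf_winPart]; rfl

/-- The scaled preconditioned residual in coordinates: `coord (P u) r = coord (C (G u)) r / S_r`. [folklore] -/
theorem coord_precondResidual (ε₀ : ℝ) (α : Fin m → Fin m → Fin m → ℤ × ℤ × ℤ → ℝ)
    (C : F.WState × ℝ → F.WState × ℝ) (u : F.Space) (r : F.WIdx) :
    F.coord (F.precondResidual ε₀ α C u) r = F.coord (C (F.gval ε₀ α u)) r / F.bscale r := by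
  rcases r with _ | ⟨i, k⟩ <;> rfl

/-! ### (K1) from a slope matrix -/

/-- **(K1) FROM A SLOPE MATRIX.** If for every two `AdmLip` points with the same tails the Krawczyk values
differ by a matrix `M` (depending on the pair) applied to the difference of the window parts, with
`|M r c| ≤ Mag r c` and all row sums of `Mag` at most `Z`, then (K1) holds in exactly the form consumed by
`krawczyk_winIn` / `krawczyk_wedge` (part V). Pure algebra: `|Σ_c M r c Δ_c| ≤ (Σ_c Mag r c) · max_c |Δ_c|`.
[cite: Tao2016AveragedNS, §5.3; cell vocabulary, harvest/h2-tao-ladder rung1/STAGE2-LEMMA.md §2–§3 (‖I − C·[DG]‖_∞ ≤ Z), rung1/KERNEL-CHEAP-REPLAY-SPEC.md §5 (v)] -/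
theorem K1_of_slope {ε₀ : ℝ} {α : Fin m → Fin m → Fin m → ℤ × ℤ × ℤ → ℝ} (C : F.WState × ℝ → F.WState × ℝ)
    (R : ℤ → ℝ) {Z : ℝ} (Mag : F.WIdx → F.WIdx → ℝ)
    (hslope : ∀ u v, F.AdmLip R u → F.AdmLip R v → u.2.2 = v.2.2 →
      ∃ M : F.WIdx → F.WIdx → ℝ, (∀ r c, |M r c| ≤ Mag r c) ∧
        ∀ r, F.coord (F.kval ε₀ α C u) r - F.coord (F.kval ε₀ α C v) r =
          ∑ c, M r c * (F.coord (F.winPart u) c - F.coord (F.winPart v) c))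
    (hrow : ∀ r, ∑ c, Mag r c ≤ Z) :
    ∀ u v, F.AdmLip R u → F.AdmLip R v → u.2.2 = v.2.2 →
      (∀ i j, |(u.1 i j - v.1 i j) -
        ((F.precondResidual ε₀ α C u).1 i j - (F.precondResidual ε₀ α C v).1 i j)| ≤ Z * dist u v) ∧
      |(u.2.1 - v.2.1) - ((F.precondResidual ε₀ α C u).2 - (F.precondResidual ε₀ α C v).2)| ≤ Z * dist u v := by
  intro u v hu hv huv
  obtain ⟨M, hM, hrep⟩ := hslope u v hu hv huv
  have key : ∀ r, |F.coord (F.kval ε₀ α C u) r - F.coord (F.kval ε₀ α C v) r| ≤ Z * dist u v := by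
    intro r
    rw [hrep r]
    calc |∑ c, M r c * (F.coord (F.winPart u) c - F.coord (F.winPart v) c)|
        ≤ ∑ c, |M r c * (F.coord (F.winPart u) c - F.coord (F.winPart v) c)| :=
          Finset.abs_sum_le_sum_abs _ _
      _ ≤ ∑ c, Mag r c * dist u v := Finset.sum_le_sum fun c _ => by
          rw [abs_mul]
          exact mul_le_mul (hM r c) (F.abs_coord_winPart_sub_le_dist u v c) (abs_nonneg _)
            ((abs_nonneg _).trans (hM r c))
      _ = (∑ c, Mag r c) * dist u v := (Finset.sum_mul _ _ _).symm
      _ ≤ Z * dist u v := mul_le_mul_of_nonneg_right (hrow r) dist_nonneg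
  refine ⟨fun i j => ?_, ?_⟩
  · have h := key (some (i, j))
    simp only [kval, coord_some, winPart, Prod.fst_sub, Pi.sub_apply] at h
    rwa [sub_sub_sub_comm] at h
  · have h := key none
    simp only [kval, coord_none, winPart, Prod.snd_sub] at h
    rwa [sub_sub_sub_comm] at h

/-! ### The slope matrix of the Krawczyk map from a slope matrix of the residual (linear preconditioner) -/

/-- **Slope of the Krawczyk map from a slope of the residual.** If the preconditioner is linear in coordinates
with matrix `Cmat`, and the residual values of two points differ by `N` applied to the difference of the
window parts (a slope matrix of `ξ ↦ G(ŷ + Sξ)` — scaled columns, unscaled rows), then the Krawczyk values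
differ by the matrix `δ_{rc} − (Σ_{r'} Cmat r r' · N r' c) / S_r` — the real-number counterpart of the engine's
`[R] = I − S⁻¹ C [DG] S`. [cite: Tao2016AveragedNS, §5.3; cell vocabulary, harvest/h2-tao-ladder rung1/STAGE2-LEMMA.md §3, rung1/KERNEL-CHEAP-REPLAY-SPEC.md §2 (Krawczyk file)] -/
theorem kval_slope_of_residualSlope {ε₀ : ℝ} {α : Fin m → Fin m → Fin m → ℤ × ℤ × ℤ → ℝ}
    {C : F.WState × ℝ → F.WState × ℝ} {Cmat : F.WIdx → F.WIdx → ℝ}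
    (hC : ∀ x r, F.coord (C x) r = ∑ r', Cmat r r' * F.coord x r') {u v : F.Space} {N : F.WIdx → F.WIdx → ℝ}
    (hN : ∀ r, F.coord (F.gval ε₀ α u) r - F.coord (F.gval ε₀ α v) r =
      ∑ c, N r c * (F.coord (F.winPart u) c - F.coord (F.winPart v) c)) (r : F.WIdx) :
    F.coord (F.kval ε₀ α C u) r - F.coord (F.kval ε₀ α C v) r =
      ∑ c, ((if r = c then 1 else 0) - (∑ r', Cmat r r' * N r' c) / F.bscale r) *
        (F.coord (F.winPart u) c - F.coord (F.winPart v) c) := by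
  classical
  -- name the coordinate differences
  obtain ⟨Δ, hΔ⟩ : ∃ Δ : F.WIdx → ℝ, ∀ c, F.coord (F.winPart u) c - F.coord (F.winPart v) c = Δ c :=
    ⟨_, fun _ => rfl⟩
  simp only [hΔ] at hN ⊢
  have hs : F.bscale r ≠ 0 := (F.bscale_pos r).ne'
  -- the two Krawczyk values in coordinates
  have hku : F.coord (F.kval ε₀ α C u) r =
      F.coord (F.winPart u) r - F.coord (C (F.gval ε₀ α u)) r / F.bscale r := by
    rw [kval, coord_sub, coord_precondResidual]
  have hkv : F.coord (F.kval ε₀ α C v) r =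
      F.coord (F.winPart v) r - F.coord (C (F.gval ε₀ α v)) r / F.bscale r := by
    rw [kval, coord_sub, coord_precondResidual]
  -- the preconditioner applied to the residual difference
  have hCdiff : F.coord (C (F.gval ε₀ α u)) r - F.coord (C (F.gval ε₀ α v)) r =
      ∑ c, (∑ r', Cmat r r' * N r' c) * Δ c := by
    rw [hC, hC, ← Finset.sum_sub_distrib]
    have e1 : ∑ r', (Cmat r r' * F.coord (F.gval ε₀ α u) r' - Cmat r r' * F.coord (F.gval ε₀ α v) r') =
        ∑ r', Cmat r r' * ∑ c, N r' c * Δ c := by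
      refine Finset.sum_congr rfl fun r' _ => ?_
      rw [← mul_sub, hN r']
    rw [e1]
    simp_rw [Finset.mul_sum, Finset.sum_mul]
    rw [Finset.sum_comm]
    refine Finset.sum_congr rfl fun c _ => Finset.sum_congr rfl fun r' _ => ?_
    ring
  -- the identity part
  have hI : ∑ c, (if r = c then (1 : ℝ) else 0) * Δ c = Δ r := by
    simp only [ite_mul, one_mul, zero_mul, Finset.sum_ite_eq, Finset.mem_univ, if_true]
  calc F.coord (F.kval ε₀ α C u) r - F.coord (F.kval ε₀ α C v) r
      = Δ r - (F.coord (C (F.gval ε₀ α u)) r - F.coord (C (F.gval ε₀ α v)) r) / F.bscale r := by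
        rw [hku, hkv, ← hΔ r]; ring
    _ = (∑ c, (if r = c then (1 : ℝ) else 0) * Δ c) - (∑ c, (∑ r', Cmat r r' * N r' c) * Δ c) / F.bscale r := by
        rw [hI, hCdiff]
    _ = ∑ c, ((if r = c then 1 else 0) - (∑ r', Cmat r r' * N r' c) / F.bscale r) * Δ c := by
        rw [Finset.sum_div, ← Finset.sum_sub_distrib]
        refine Finset.sum_congr rfl fun c _ => ?_
        ring

/-- **(K1) FROM AN INTERVAL SLOPE MATRIX OF THE RESIDUAL and interval linear algebra.** Linear preconditioner
`Cmat`; for every two `AdmLip` points with the same tails a slope matrix `N` of the residual (scaled columns)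
inside the interval matrix `[Nlo, Nhi]`; magnitude bounds `Mag` of `I − S⁻¹ C N` valid for EVERY real matrix
`N ∈ [Nlo, Nhi]` (what an interval evaluation of `[R] = I − S⁻¹ C [N]` certifies); row sums of `Mag` at most `Z`.
Then (K1) holds with constant `Z`. This is the statement the Krawczyk file of a kernel replay discharges; the
flight time is just the column `none` of `N` (a Lipschitz slope), no differentiability in it is involved.
[cite: Tao2016AveragedNS, §5.3; cell vocabulary, harvest/h2-tao-ladder rung1/STAGE2-LEMMA.md §2–§3, rung1/KERNEL-CHEAP-REPLAY-SPEC.md §2/§5 (v)] -/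
theorem K1_of_residualSlope {ε₀ : ℝ} {α : Fin m → Fin m → Fin m → ℤ × ℤ × ℤ → ℝ}
    (C : F.WState × ℝ → F.WState × ℝ) {Cmat : F.WIdx → F.WIdx → ℝ}
    (hC : ∀ x r, F.coord (C x) r = ∑ r', Cmat r r' * F.coord x r') (R : ℤ → ℝ) {Z : ℝ}
    (Nlo Nhi Mag : F.WIdx → F.WIdx → ℝ)
    (hN : ∀ u v, F.AdmLip R u → F.AdmLip R v → u.2.2 = v.2.2 →
      ∃ N : F.WIdx → F.WIdx → ℝ, (∀ r c, Nlo r c ≤ N r c ∧ N r c ≤ Nhi r c) ∧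
        ∀ r, F.coord (F.gval ε₀ α u) r - F.coord (F.gval ε₀ α v) r =
          ∑ c, N r c * (F.coord (F.winPart u) c - F.coord (F.winPart v) c))
    (hMag : ∀ N : F.WIdx → F.WIdx → ℝ, (∀ r c, Nlo r c ≤ N r c ∧ N r c ≤ Nhi r c) →
      ∀ r c, |(if r = c then 1 else 0) - (∑ r', Cmat r r' * N r' c) / F.bscale r| ≤ Mag r c)
    (hrow : ∀ r, ∑ c, Mag r c ≤ Z) :
    ∀ u v, F.AdmLip R u → F.AdmLip R v → u.2.2 = v.2.2 →
      (∀ i j, |(u.1 i j - v.1 i j) -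
        ((F.precondResidual ε₀ α C u).1 i j - (F.precondResidual ε₀ α C v).1 i j)| ≤ Z * dist u v) ∧
      |(u.2.1 - v.2.1) - ((F.precondResidual ε₀ α C u).2 - (F.precondResidual ε₀ α C v).2)| ≤ Z * dist u v := by
  classical
  refine F.K1_of_slope C R Mag (fun u v hu hv huv => ?_) hrow
  obtain ⟨N, hNin, hNrep⟩ := hN u v hu hv huv
  exact ⟨fun r c => (if r = c then 1 else 0) - (∑ r', Cmat r r' * N r' c) / F.bscale r, hMag N hNin,
    fun r => F.kval_slope_of_residualSlope hC hNrep r⟩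

/-! ### Where slope matrices come from: row-wise derivatives (mean value theorem) and Lipschitz columns -/

/-- **A slope ROW from a row-wise derivative within a convex set** (scalar mean value theorem on the segment):
if `φ : WState × ℝ → ℝ` has within the convex set `s` a derivative `φ' x` at every `x ∈ s`, then for `a, b ∈ s`
there is an intermediate point `z ∈ s` with `φ a − φ b = Σ_c (φ' z) (e_c) · (coord a c − coord b c)`. Each row
of a vector-valued map gets ITS OWN intermediate point — which is all a slope matrix asks for.
[folklore; cite: cell vocabulary, harvest/h2-tao-ladder rung1/KERNEL-CHEAP-REPLAY-SPEC.md §5 (v)] -/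
theorem exists_slope_row_of_hasFDerivWithinAt {s : Set (F.WState × ℝ)} (hs : Convex ℝ s)
    {φ : F.WState × ℝ → ℝ} {φ' : F.WState × ℝ → (F.WState × ℝ) →L[ℝ] ℝ}
    (hφ : ∀ x ∈ s, HasFDerivWithinAt φ (φ' x) s x) {a b : F.WState × ℝ} (ha : a ∈ s) (hb : b ∈ s) :
    ∃ z ∈ s, φ a - φ b = ∑ c, (φ' z) (F.eIdx c) * (F.coord a c - F.coord b c) := by
  -- the segment `γ θ = b + θ (a − b)` lies in `s`
  set γ : ℝ → F.WState × ℝ := fun θ => b + θ • (a - b) with hγ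
  have hγmem : ∀ θ ∈ Icc (0 : ℝ) 1, γ θ ∈ s := by
    intro θ hθ
    have := hs hb ha (sub_nonneg.2 hθ.2) hθ.1 (sub_add_cancel 1 θ)
    convert this using 1
    simp only [hγ, smul_sub]
    module
  have hγ0 : γ 0 = b := by simp [hγ]
  have hγ1 : γ 1 = a := by simp [hγ]
  -- derivative of the segment map and of the composition, within `[0, 1]`
  have hγd : ∀ θ, HasDerivAt γ (a - b) θ := fun θ => by
    simpa [hγ] using ((hasDerivAt_id θ).smul_const (a - b)).const_add b
  have hcomp : ∀ θ ∈ Icc (0 : ℝ) 1, HasDerivWithinAt (φ ∘ γ) ((φ' (γ θ)) (a - b)) (Icc 0 1) θ := by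
    intro θ hθ
    exact (hφ (γ θ) (hγmem θ hθ)).comp_hasDerivWithinAt θ (hγd θ).hasDerivWithinAt
      (fun θ' hθ' => hγmem θ' hθ')
  have hcont : ContinuousOn (φ ∘ γ) (Icc 0 1) := fun θ hθ => (hcomp θ hθ).continuousWithinAt
  have hderiv : ∀ θ ∈ Ioo (0 : ℝ) 1, HasDerivAt (φ ∘ γ) ((φ' (γ θ)) (a - b)) θ := fun θ hθ =>
    (hcomp θ (Ioo_subset_Icc_self hθ)).hasDerivAt (Icc_mem_nhds hθ.1 hθ.2)
  obtain ⟨θ, hθ, hslope⟩ := exists_hasDerivAt_eq_slope (φ ∘ γ) (fun θ => (φ' (γ θ)) (a - b)) zero_lt_one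
    hcont hderiv
  refine ⟨γ θ, hγmem θ (Ioo_subset_Icc_self hθ), ?_⟩
  have hval : φ a - φ b = (φ' (γ θ)) (a - b) := by
    have := hslope
    simp only [Function.comp_apply, hγ1, hγ0, sub_zero, div_one] at this
    exact this.symm
  rw [hval]
  conv_lhs => rw [← F.sum_coord_smul_eIdx (a - b)]
  simp only [map_sum, map_smul, smul_eq_mul, coord_sub]
  exact Finset.sum_congr rfl fun c _ => mul_comm _ _

/-- **A slope from a Lipschitz bound** (one real variable): `|f x − f y| ≤ L |x − y|` gives `f x − f y = μ (x − y)`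
with `|μ| ≤ L` (the difference quotient, or `0`). [folklore] -/
theorem exists_slope_of_lipschitz {f : ℝ → ℝ} {L : ℝ} (hL : 0 ≤ L) {x y : ℝ}
    (h : |f x - f y| ≤ L * |x - y|) : ∃ μ : ℝ, |μ| ≤ L ∧ f x - f y = μ * (x - y) := by
  by_cases hxy : x = y
  · subst hxy; exact ⟨0, by simpa using hL, by simp⟩
  · have hne : x - y ≠ 0 := sub_ne_zero.2 hxy
    refine ⟨(f x - f y) / (x - y), ?_, (div_mul_cancel₀ _ hne).symm⟩
    rw [abs_div, div_le_iff₀ (abs_pos.2 hne)]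
    exact h

/-! ### The mixed form of SPEC §5 (v): derivative in the window start, Lipschitz in the flight time -/

/-- The point of `WState × ℝ` with window start `y` and flight-time coordinate `θ`. [folklore] -/
def withTau (y : F.WState) (θ : ℝ) : F.WState × ℝ := (y, θ)

/-- **(K1) FROM A DERIVATIVE IN THE WINDOW START AND A LIPSCHITZ FLIGHT-TIME COLUMN** (the sibling of part
VIII announced in KERNEL-CHEAP-REPLAY-SPEC §5 (v)). Hypotheses, for every tail part `t` of an `AdmLip` point:
(a) for every flight-time coordinate `θ ∈ [−1, 1]` and every row `r`, the row `ξ ↦ coord (krawczykMap t ξ) r`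
has within the slab `closedBall 0 1` a derivative whose window entries are bounded in magnitude by `Mag r (some ·)`
(an interval y-block of `[R]`); (b) for every window start `y` in the unit ball, the row is `Mag r none`-Lipschitz
in the flight-time coordinate on `[−1, 1]`; (c) all full row sums of `Mag` are at most `Z`. Then (K1) holds with
`Z`: split `u → w → v` through `w` = (window start of `v`, flight time of `u`); (a) gives a slope row on the window
columns (`exists_slope_row_of_hasFDerivWithinAt`), (b) a slope on the column `none`; then `K1_of_slope`.
[cite: Tao2016AveragedNS, §5.3; cell vocabulary, harvest/h2-tao-ladder rung1/STAGE2-LEMMA.md §2–§3, rung1/KERNEL-CHEAP-REPLAY-SPEC.md §5 (v)] -/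
theorem K1_of_fderiv_y_lipschitz_τ {ε₀ : ℝ} {α : Fin m → Fin m → Fin m → ℤ × ℤ × ℤ → ℝ}
    (C : F.WState × ℝ → F.WState × ℝ) (R : ℤ → ℝ) {Z : ℝ} (Mag : F.WIdx → F.WIdx → ℝ)
    {L : lp (fun _ : F.TailIdx => ℝ) ⊤ → F.WIdx → F.WState × ℝ → (F.WState × ℝ) →L[ℝ] ℝ}
    (hderiv : ∀ u, F.AdmLip R u → ∀ r, ∀ ξ ∈ closedBall (0 : F.WState × ℝ) 1,
      HasFDerivWithinAt (fun ξ' => F.coord (F.krawczykMap ε₀ α C u.2.2 ξ') r) (L u.2.2 r ξ)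
        (closedBall (0 : F.WState × ℝ) 1) ξ)
    (hentry : ∀ u, F.AdmLip R u → ∀ r, ∀ ξ ∈ closedBall (0 : F.WState × ℝ) 1, ∀ j l,
      |(L u.2.2 r ξ) (F.eW j l)| ≤ Mag r (some (j, l)))
    (hlipτ : ∀ u, F.AdmLip R u → ∀ r, ∀ y ∈ closedBall (0 : F.WState) 1,
      ∀ θ ∈ Icc (-1 : ℝ) 1, ∀ θ' ∈ Icc (-1 : ℝ) 1,
      |F.coord (F.krawczykMap ε₀ α C u.2.2 (F.withTau y θ)) r -
        F.coord (F.krawczykMap ε₀ α C u.2.2 (F.withTau y θ')) r| ≤ Mag r none * |θ - θ'|)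
    (hMag : ∀ r c, 0 ≤ Mag r c) (hrow : ∀ r, ∑ c, Mag r c ≤ Z) :
    ∀ u v, F.AdmLip R u → F.AdmLip R v → u.2.2 = v.2.2 →
      (∀ i j, |(u.1 i j - v.1 i j) -
        ((F.precondResidual ε₀ α C u).1 i j - (F.precondResidual ε₀ α C v).1 i j)| ≤ Z * dist u v) ∧
      |(u.2.1 - v.2.1) - ((F.precondResidual ε₀ α C u).2 - (F.precondResidual ε₀ α C v).2)| ≤ Z * dist u v := by
  classical
  refine F.K1_of_slope C R Mag (fun u v hu hv huv => ?_) hrow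
  -- the three window parts: `ξu = (y_u, θ_u)`, `ξw = (y_v, θ_u)`, `ξv = (y_v, θ_v)`
  set t := u.2.2 with ht
  have hxu := F.winPart_mem_closedBall hu
  have hxv := F.winPart_mem_closedBall hv
  have hθu : u.2.1 ∈ Icc (-1 : ℝ) 1 := abs_le.1 hu.1.2.1
  have hθv : v.2.1 ∈ Icc (-1 : ℝ) 1 := abs_le.1 hv.1.2.1
  have hyv : v.1 ∈ closedBall (0 : F.WState) 1 := by
    rw [mem_closedBall_zero_iff]
    exact (pi_norm_le_iff_of_nonneg zero_le_one).2 fun i =>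
      (pi_norm_le_iff_of_nonneg zero_le_one).2 fun k => by rw [Real.norm_eq_abs]; exact hv.1.1 i k
  have hxw : F.withTau v.1 u.2.1 ∈ closedBall (0 : F.WState × ℝ) 1 := by
    rw [mem_closedBall_zero_iff, withTau, Prod.norm_def]
    refine max_le (mem_closedBall_zero_iff.1 hyv) ?_
    rw [Real.norm_eq_abs]; exact hu.1.2.1
  -- values of the Krawczyk map at the three points
  have hKu : F.kval ε₀ α C u = F.krawczykMap ε₀ α C t (F.winPart u) := F.kval_eq_krawczykMap ε₀ α C u
  have hKv : F.kval ε₀ α C v = F.krawczykMap ε₀ α C t (F.winPart v) := by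
    rw [F.kval_eq_krawczykMap, ← huv]
  -- (a): slope row on the window columns between `ξu` and `ξw` (same flight-time coordinate)
  have hrowY : ∀ r, ∃ My : F.WIdx → ℝ, (∀ c, |My c| ≤ Mag r c) ∧ My none = 0 ∧
      F.coord (F.krawczykMap ε₀ α C t (F.winPart u)) r - F.coord (F.krawczykMap ε₀ α C t (F.withTau v.1 u.2.1)) r =
        ∑ c, My c * (F.coord (F.winPart u) c - F.coord (F.withTau v.1 u.2.1) c) := by
    intro r
    obtain ⟨z, hz, hz'⟩ := F.exists_slope_row_of_hasFDerivWithinAt (convex_closedBall _ _)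
      (fun x hx => hderiv u hu r x hx) hxu hxw
    refine ⟨fun c => c.elim 0 fun p => (L t r z) (F.eW p.1 p.2), fun c => ?_, rfl, ?_⟩
    · rcases c with _ | ⟨j, l⟩
      · simpa using hMag r none
      · exact hentry u hu r z hz j l
    · rw [hz', Fintype.sum_option, Fintype.sum_option]
      have h0 : F.coord (F.winPart u) none - F.coord (F.withTau v.1 u.2.1) none = 0 := by
        simp [winPart, withTau]
      simp only [h0, mul_zero, zero_add]
      exact Finset.sum_congr rfl fun p _ => rfl
  -- (b): slope on the flight-time column between `ξw` and `ξv` (same window start)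
  have hrowT : ∀ r, ∃ μ : ℝ, |μ| ≤ Mag r none ∧
      F.coord (F.krawczykMap ε₀ α C t (F.withTau v.1 u.2.1)) r - F.coord (F.krawczykMap ε₀ α C t (F.winPart v)) r =
        μ * (u.2.1 - v.2.1) := by
    intro r
    have h := hlipτ u hu r v.1 hyv u.2.1 hθu v.2.1 hθv
    exact exists_slope_of_lipschitz (f := fun θ => F.coord (F.krawczykMap ε₀ α C t (F.withTau v.1 θ)) r)
      (hMag r none) h
  -- assemble the slope matrix row by row
  choose My hMy hMy0 hMyrep using hrowY
  choose μ hμ hμrep using hrowT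
  refine ⟨fun r c => c.elim (μ r) fun _ => My r c, fun r c => ?_, fun r => ?_⟩
  · rcases c with _ | ⟨j, l⟩
    · exact hμ r
    · exact hMy r (some (j, l))
  · rw [hKu, hKv]
    have esplit : F.coord (F.krawczykMap ε₀ α C t (F.winPart u)) r - F.coord (F.krawczykMap ε₀ α C t (F.winPart v)) r =
        (F.coord (F.krawczykMap ε₀ α C t (F.winPart u)) r -
          F.coord (F.krawczykMap ε₀ α C t (F.withTau v.1 u.2.1)) r) +
        (F.coord (F.krawczykMap ε₀ α C t (F.withTau v.1 u.2.1)) r -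
          F.coord (F.krawczykMap ε₀ α C t (F.winPart v)) r) := by ring
    rw [esplit, hMyrep r, hμrep r, Fintype.sum_option, Fintype.sum_option, hMy0 r]
    simp only [Option.elim, zero_mul, zero_add, coord_none, winPart, withTau, coord_some']
    ring

end OneShiftFrame

end DSSOneShift

end Summit.NavierStokesRegularity.NavierStokesRegularity.Theorems
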